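import Summits.RiemannHypothesis.RiemannHypothesis.Theorems.PfPersistenceM2DilationStability
import Summits.RiemannHypothesis.RiemannHypothesis.Theorems.PfPersistenceM2IndexMonotone
import HarnessLib

/-!
# Pf-persistence index route (M2): the thresholds are NOT attained — level sets are open rays

Long-odds MECHANISM SEARCH (cell `pub-rhpf`, seat M2); every result here is RH-free, unconditional,
and makes no claim about RH.  Notation as in `PfPersistenceM2ShortWindows` /
`PfPersistenceM2IndexMonotone`: `K = #𝒬 ∈ ℕ ∪ {∞}` counts the off-line quadruples of zeta zeros,
`Even/Odd/RealNegIndexAtLeast n a` are the window index predicates ("`[-a, a]` carries `n`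
independent negative directions of Weil's quadratic functional `Q` in the even / odd / real
sector"), and `aₙ = sInf {a | EvenNegIndexAtLeast (n+1) a}` is the threshold window of level
`n + 1` (`exists_evenNegIndex_threshold`, which is SILENT at `a = aₙ`).

PROVED here (RH-free, unconditional), closing the point left open by the threshold theorems,
from the dilation-stability kernel `exists_pos_negDef_weilDilate`
(`PfPersistenceM2DilationStability`):

* `EvenNegIndexAtLeast.exists_lt` (and odd / real) — every level that occurs on `[-a, a]` already
  occurs on a strictly shorter window (dilate a negative frame; the dilates are even / odd,
  real-valued, smooth, supported in `[-a/(1+η), a/(1+η)]`);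
* `isOpen_setOf_evenNegIndexAtLeast` (and odd / real) — the level sets `{a | ·NegIndexAtLeast n a}`
  are OPEN; being upper sets bounded below by `(log 2)/2` (Yoshida), each non-empty one is the open
  ray `(aₙ, ∞)`: `evenNegIndexAtLeast_succ_iff_sInf_lt` (`n + 1 ≤ K`; odd: `n + 1 ≤ K`; real:
  `n + 1 ≤ 2K`), `exists_evenNegIndex_threshold_iff` (and odd / real);
* `not_evenNegIndexAtLeast_succ_sInf` (and odd / real) — **the threshold window itself does not
  carry the level**: `¬ EvenNegIndexAtLeast (n+1) aₙ`, for every `n` (no hypothesis on `K`);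
* `lowerSemicontinuous_evenNegIndex` (and odd / real), `iSup_lt_evenNegIndex_eq` (and real) — the
  window index `a ↦ ind⁻(a) ∈ ℕ∞` is lower semicontinuous and left-continuous: it jumps just
  AFTER each threshold, never at it.

Read against Bombieri's variational picture [cite: Bombieri2000Weil, §4 Thm 5 and its proof (the
dilation `f_ε`, continuity of the infimum in `M`)]: the negative index of the window form at `a` is
the number of thresholds strictly below `a`.  Nothing here bears on whether any threshold exists
(`K ≥ 1 ⟺ ¬ RH`), and nothing is claimed about it.
-/

noncomputable section

open Filter Set Metric
open scoped Topology

namespace Summit.RiemannHypothesis.RiemannHypothesis.Theorems.PfPersistenceM2NegIndex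

open Literature.NumberTheory.LFunctions
open Literature.NumberTheory.LFunctions.ZetaZeros
open Summit.RiemannHypothesis.RiemannHypothesis.Theorems.PfPersistenceParityIndex (OddNegIndexAtLeast)

-- `𝒬` = the open quadrant of non-trivial zeros, `Re ρ > 1/2`, `Im ρ > 0` (one representative per
-- off-line quadruple); a NOTATION (not a definition), literally the set of the M2 files.
set_option quotPrecheck false in
local notation "𝒬" => {ρ : ℂ | ρ ∈ riemannZetaNontrivialZeros ∧ 1 / 2 < ρ.re ∧ 0 < ρ.im}

/-! ## C. Every level occurs already on a strictly shorter window -/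

/-- **Even sector: a level carried by `[-a, a]` is carried by a strictly shorter window**
(`∃ b < a, EvenNegIndexAtLeast n b`): dilate a negative `n`-frame by a small `η > 0`
(`exists_pos_negDef_weilDilate`); the dilates are even, real-valued, smooth, supported in
`[-a/(1+η), a/(1+η)]`.  RH-free. [folklore] -/
theorem EvenNegIndexAtLeast.exists_lt {n : ℕ} {a : ℝ} (h : EvenNegIndexAtLeast n a) :
    ∃ b < a, EvenNegIndexAtLeast n b := by
  rcases n with _ | m
  · exact ⟨a - 1, by linarith, fun i ↦ i.elim0, fun i ↦ i.elim0, fun i ↦ i.elim0, fun i ↦ i.elim0,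
      fun i ↦ i.elim0, fun c hc ↦ absurd (Subsingleton.elim c 0) hc⟩
  have ha : 0 < a := by
    by_contra hle
    exact not_evenNegIndexAtLeast_succ_of_le_log_two_half
      ((not_lt.1 hle).trans (div_nonneg (Real.log_nonneg (by norm_num)) (by norm_num))) m h
  obtain ⟨g, htest, heven, hreal, hsupp, hneg⟩ := h
  obtain ⟨η, hη, hnegη⟩ := exists_pos_negDef_weilDilate htest hneg
  have hη' : (-1 : ℝ) < η := by linarith
  exact ⟨a / (1 + η), div_lt_self ha (by linarith), fun i ↦ weilDilate η (g i),
    fun i ↦ (htest i).weilDilate hη', fun i t ↦ weilDilate_even (heven i) η t,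
    fun i t ↦ weilDilate_im_eq_zero (hreal i) η t,
    fun i ↦ tsupport_weilDilate_subset (g i) hη' (hsupp i), hnegη⟩

/-- **Odd sector**: `OddNegIndexAtLeast n a ⟹ ∃ b < a, OddNegIndexAtLeast n b`. RH-free. [folklore] -/
theorem exists_lt_of_oddNegIndexAtLeast {n : ℕ} {a : ℝ} (h : OddNegIndexAtLeast n a) :
    ∃ b < a, OddNegIndexAtLeast n b := by
  rcases n with _ | m
  · exact ⟨a - 1, by linarith, fun i ↦ i.elim0, fun i ↦ i.elim0, fun i ↦ i.elim0, fun i ↦ i.elim0,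
      fun i ↦ i.elim0, fun c hc ↦ absurd (Subsingleton.elim c 0) hc⟩
  have ha : 0 < a := by
    by_contra hle
    exact not_oddNegIndexAtLeast_succ_of_le_log_two_half
      ((not_lt.1 hle).trans (div_nonneg (Real.log_nonneg (by norm_num)) (by norm_num))) m h
  obtain ⟨g, htest, hodd, hreal, hsupp, hneg⟩ := h
  obtain ⟨η, hη, hnegη⟩ := exists_pos_negDef_weilDilate htest hneg
  have hη' : (-1 : ℝ) < η := by linarith
  exact ⟨a / (1 + η), div_lt_self ha (by linarith), fun i ↦ weilDilate η (g i),
    fun i ↦ (htest i).weilDilate hη', fun i t ↦ weilDilate_odd (hodd i) η t,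
    fun i t ↦ weilDilate_im_eq_zero (hreal i) η t,
    fun i ↦ tsupport_weilDilate_subset (g i) hη' (hsupp i), hnegη⟩

/-- **Real sector**: `RealNegIndexAtLeast n a ⟹ ∃ b < a, RealNegIndexAtLeast n b`. RH-free. [folklore] -/
theorem RealNegIndexAtLeast.exists_lt {n : ℕ} {a : ℝ} (h : RealNegIndexAtLeast n a) :
    ∃ b < a, RealNegIndexAtLeast n b := by
  rcases n with _ | m
  · exact ⟨a - 1, by linarith, fun i ↦ i.elim0, fun i ↦ i.elim0, fun i ↦ i.elim0, fun i ↦ i.elim0,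
      fun c hc ↦ absurd (Subsingleton.elim c 0) hc⟩
  have ha : 0 < a := by
    by_contra hle
    exact not_realNegIndexAtLeast_succ_of_le_log_two_half
      ((not_lt.1 hle).trans (div_nonneg (Real.log_nonneg (by norm_num)) (by norm_num))) m h
  obtain ⟨g, htest, hreal, hsupp, hneg⟩ := h
  obtain ⟨η, hη, hnegη⟩ := exists_pos_negDef_weilDilate htest hneg
  have hη' : (-1 : ℝ) < η := by linarith
  exact ⟨a / (1 + η), div_lt_self ha (by linarith), fun i ↦ weilDilate η (g i),
    fun i ↦ (htest i).weilDilate hη', fun i t ↦ weilDilate_im_eq_zero (hreal i) η t,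
    fun i ↦ tsupport_weilDilate_subset (g i) hη' (hsupp i), hnegη⟩

/-! ## D. The level sets are open rays; the thresholds are not attained -/

/-- **The even level sets are open** in the window variable. RH-free. [folklore] -/
theorem isOpen_setOf_evenNegIndexAtLeast (n : ℕ) : IsOpen {a : ℝ | EvenNegIndexAtLeast n a} :=
  isOpen_iff_mem_nhds.2 fun a ha ↦ by
    obtain ⟨b, hba, hb⟩ := EvenNegIndexAtLeast.exists_lt ha
    exact mem_of_superset (Ioi_mem_nhds hba) fun x hx ↦ hb.mono (le_of_lt hx)

/-- The odd level sets are open. RH-free. [folklore] -/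
theorem isOpen_setOf_oddNegIndexAtLeast (n : ℕ) : IsOpen {a : ℝ | OddNegIndexAtLeast n a} :=
  isOpen_iff_mem_nhds.2 fun a ha ↦ by
    obtain ⟨b, hba, hb⟩ := exists_lt_of_oddNegIndexAtLeast ha
    exact mem_of_superset (Ioi_mem_nhds hba) fun x hx ↦ hb.mono (le_of_lt hx)

/-- The real level sets are open. RH-free. [folklore] -/
theorem isOpen_setOf_realNegIndexAtLeast (n : ℕ) : IsOpen {a : ℝ | RealNegIndexAtLeast n a} :=
  isOpen_iff_mem_nhds.2 fun a ha ↦ by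
    obtain ⟨b, hba, hb⟩ := RealNegIndexAtLeast.exists_lt ha
    exact mem_of_superset (Ioi_mem_nhds hba) fun x hx ↦ hb.mono (le_of_lt hx)

/-- Abstract: a non-empty, bounded-below, open upper set of reals is the open ray above its
infimum. [folklore] -/
theorem setOf_eq_Ioi_sInf_of_isOpen {P : ℝ → Prop} (hne : {a : ℝ | P a}.Nonempty)
    (hbdd : BddBelow {a : ℝ | P a}) (hopen : IsOpen {a : ℝ | P a})
    (hmono : ∀ a b, P a → a ≤ b → P b) :
    {a : ℝ | P a} = Ioi (sInf {a : ℝ | P a}) := by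
  ext x
  refine ⟨fun hx ↦ ?_, fun hx ↦ ?_⟩
  · obtain ⟨ε, hε, hball⟩ := Metric.isOpen_iff.1 hopen x hx
    have hb : P (x - ε / 2) := hball (by
      rw [mem_ball, Real.dist_eq, show x - ε / 2 - x = -(ε / 2) by ring, abs_neg,
        abs_of_pos (by positivity)]
      linarith)
    exact lt_of_le_of_lt (csInf_le hbdd hb) (by linarith)
  · obtain ⟨b, hb, hbx⟩ := exists_lt_of_csInf_lt hne hx
    exact hmono b x hb hbx.le

/-- The even level-`(n+1)` set is bounded below by `(log 2)/2` (Yoshida). [cite: Yoshida1992, Thm. 1 (p. 310)] -/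
theorem bddBelow_setOf_evenNegIndexAtLeast_succ (n : ℕ) :
    BddBelow {a : ℝ | EvenNegIndexAtLeast (n + 1) a} :=
  ⟨Real.log 2 / 2, fun a ha ↦ by
    by_contra hlt
    exact not_evenNegIndexAtLeast_succ_of_le_log_two_half (le_of_lt (not_le.1 hlt)) n ha⟩

/-- The odd level-`(n+1)` set is bounded below by `(log 2)/2`. [cite: Yoshida1992, Thm. 1 (p. 310)] -/
theorem bddBelow_setOf_oddNegIndexAtLeast_succ (n : ℕ) :
    BddBelow {a : ℝ | OddNegIndexAtLeast (n + 1) a} :=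
  ⟨Real.log 2 / 2, fun a ha ↦ by
    by_contra hlt
    exact not_oddNegIndexAtLeast_succ_of_le_log_two_half (le_of_lt (not_le.1 hlt)) n ha⟩

/-- The real level-`(n+1)` set is bounded below by `(log 2)/2`. [cite: Yoshida1992, Thm. 1 (p. 310)] -/
theorem bddBelow_setOf_realNegIndexAtLeast_succ (n : ℕ) :
    BddBelow {a : ℝ | RealNegIndexAtLeast (n + 1) a} :=
  ⟨Real.log 2 / 2, fun a ha ↦ by
    by_contra hlt
    exact not_realNegIndexAtLeast_succ_of_le_log_two_half (le_of_lt (not_le.1 hlt)) n ha⟩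

/-- **The even level set of level `n + 1 ≤ K` is exactly the OPEN ray `(aₙ, ∞)`**,
`aₙ = sInf {a | EvenNegIndexAtLeast (n+1) a}`: this sharpens `exists_evenNegIndex_threshold`
(which is silent at `a = aₙ`) — the threshold window itself does not carry the level.  RH-free.
[cite: Bombieri2000Weil, §4 Thm 5 (proof: the dilation); Yoshida1992, Thm. 1] -/
theorem evenNegIndexAtLeast_succ_iff_sInf_lt {n : ℕ} (hK : ((n + 1 : ℕ) : ℕ∞) ≤ Set.encard 𝒬)
    (a : ℝ) :
    EvenNegIndexAtLeast (n + 1) a ↔ sInf {a : ℝ | EvenNegIndexAtLeast (n + 1) a} < a := by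
  have h := setOf_eq_Ioi_sInf_of_isOpen ((exists_evenNegIndexAtLeast_iff_encard (n + 1)).2 hK)
    (bddBelow_setOf_evenNegIndexAtLeast_succ n) (isOpen_setOf_evenNegIndexAtLeast (n + 1))
    fun _ _ h hab ↦ EvenNegIndexAtLeast.mono h hab
  exact Set.ext_iff.1 h a

/-- Odd version (`n + 1 ≤ K`). RH-free. [cite: Bombieri2000Weil, §4 Thm 5 (proof: the dilation); Yoshida1992, Thm. 1] -/
theorem oddNegIndexAtLeast_succ_iff_sInf_lt {n : ℕ} (hK : ((n + 1 : ℕ) : ℕ∞) ≤ Set.encard 𝒬)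
    (a : ℝ) :
    OddNegIndexAtLeast (n + 1) a ↔ sInf {a : ℝ | OddNegIndexAtLeast (n + 1) a} < a := by
  have h := setOf_eq_Ioi_sInf_of_isOpen ((exists_oddNegIndexAtLeast_iff_encard (n + 1)).2 hK)
    (bddBelow_setOf_oddNegIndexAtLeast_succ n) (isOpen_setOf_oddNegIndexAtLeast (n + 1))
    fun _ _ h hab ↦ PfPersistenceParityIndex.OddNegIndexAtLeast.mono h hab
  exact Set.ext_iff.1 h a

/-- Real version (`n + 1 ≤ 2K`). RH-free. [cite: Bombieri2000Weil, §4 Thm 5 (proof: the dilation); Yoshida1992, Thm. 1] -/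
theorem realNegIndexAtLeast_succ_iff_sInf_lt {n : ℕ} (hK : ((n + 1 : ℕ) : ℕ∞) ≤ 2 * Set.encard 𝒬)
    (a : ℝ) :
    RealNegIndexAtLeast (n + 1) a ↔ sInf {a : ℝ | RealNegIndexAtLeast (n + 1) a} < a := by
  have h := setOf_eq_Ioi_sInf_of_isOpen ((exists_realNegIndexAtLeast_iff_encard (n + 1)).2 hK)
    (bddBelow_setOf_realNegIndexAtLeast_succ n) (isOpen_setOf_realNegIndexAtLeast (n + 1))
    fun _ _ h hab ↦ RealNegIndexAtLeast.mono h hab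
  exact Set.ext_iff.1 h a

/-- **The even threshold window does not carry its level**: `¬ EvenNegIndexAtLeast (n+1) aₙ`
(for every `n`; if the level never occurs the statement is about `sInf ∅ = 0` and holds by
Yoshida).  RH-free. [folklore] -/
theorem not_evenNegIndexAtLeast_succ_sInf (n : ℕ) :
    ¬ EvenNegIndexAtLeast (n + 1) (sInf {a : ℝ | EvenNegIndexAtLeast (n + 1) a}) := by
  intro h
  obtain ⟨b, hb, hPb⟩ := h.exists_lt
  exact absurd (csInf_le (bddBelow_setOf_evenNegIndexAtLeast_succ n) hPb) (not_le.2 hb)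

/-- Odd version: `¬ OddNegIndexAtLeast (n+1) (sInf {a | OddNegIndexAtLeast (n+1) a})`. RH-free. [folklore] -/
theorem not_oddNegIndexAtLeast_succ_sInf (n : ℕ) :
    ¬ OddNegIndexAtLeast (n + 1) (sInf {a : ℝ | OddNegIndexAtLeast (n + 1) a}) := by
  intro h
  obtain ⟨b, hb, hPb⟩ := exists_lt_of_oddNegIndexAtLeast h
  exact absurd (csInf_le (bddBelow_setOf_oddNegIndexAtLeast_succ n) hPb) (not_le.2 hb)

/-- Real version: `¬ RealNegIndexAtLeast (n+1) (sInf {a | RealNegIndexAtLeast (n+1) a})`. RH-free. [folklore] -/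
theorem not_realNegIndexAtLeast_succ_sInf (n : ℕ) :
    ¬ RealNegIndexAtLeast (n + 1) (sInf {a : ℝ | RealNegIndexAtLeast (n + 1) a}) := by
  intro h
  obtain ⟨b, hb, hPb⟩ := h.exists_lt
  exact absurd (csInf_le (bddBelow_setOf_realNegIndexAtLeast_succ n) hPb) (not_le.2 hb)

/-- **Sharp even threshold theorem** (`n + 1 ≤ K`): there is `aₙ ≥ (log 2)/2` with
`EvenNegIndexAtLeast (n+1) a ⟺ aₙ < a` for EVERY `a` — including `a = aₙ`, where the level is
absent.  RH-free. [cite: Bombieri2000Weil, §4 Thm 5, Thm 9; Yoshida1992, Thm. 1] -/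
theorem exists_evenNegIndex_threshold_iff {n : ℕ} (hK : ((n + 1 : ℕ) : ℕ∞) ≤ Set.encard 𝒬) :
    ∃ a₀ : ℝ, Real.log 2 / 2 ≤ a₀ ∧ ∀ a : ℝ, EvenNegIndexAtLeast (n + 1) a ↔ a₀ < a := by
  refine ⟨sInf {a : ℝ | EvenNegIndexAtLeast (n + 1) a}, ?_,
    evenNegIndexAtLeast_succ_iff_sInf_lt hK⟩
  exact le_csInf ((exists_evenNegIndexAtLeast_iff_encard (n + 1)).2 hK) fun a ha ↦ by
    by_contra hlt
    exact not_evenNegIndexAtLeast_succ_of_le_log_two_half (le_of_lt (not_le.1 hlt)) n ha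

/-- Sharp odd threshold theorem (`n + 1 ≤ K`). RH-free. [cite: Bombieri2000Weil, §4 Thm 5, Thm 9; Yoshida1992, Thm. 1] -/
theorem exists_oddNegIndex_threshold_iff {n : ℕ} (hK : ((n + 1 : ℕ) : ℕ∞) ≤ Set.encard 𝒬) :
    ∃ a₀ : ℝ, Real.log 2 / 2 ≤ a₀ ∧ ∀ a : ℝ, OddNegIndexAtLeast (n + 1) a ↔ a₀ < a := by
  refine ⟨sInf {a : ℝ | OddNegIndexAtLeast (n + 1) a}, ?_, oddNegIndexAtLeast_succ_iff_sInf_lt hK⟩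
  exact le_csInf ((exists_oddNegIndexAtLeast_iff_encard (n + 1)).2 hK) fun a ha ↦ by
    by_contra hlt
    exact not_oddNegIndexAtLeast_succ_of_le_log_two_half (le_of_lt (not_le.1 hlt)) n ha

/-- Sharp real threshold theorem (`n + 1 ≤ 2K`). RH-free. [cite: Bombieri2000Weil, §4 Thm 5, Thm 8; Yoshida1992, Thm. 1] -/
theorem exists_realNegIndex_threshold_iff {n : ℕ} (hK : ((n + 1 : ℕ) : ℕ∞) ≤ 2 * Set.encard 𝒬) :
    ∃ a₀ : ℝ, Real.log 2 / 2 ≤ a₀ ∧ ∀ a : ℝ, RealNegIndexAtLeast (n + 1) a ↔ a₀ < a := by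
  refine ⟨sInf {a : ℝ | RealNegIndexAtLeast (n + 1) a}, ?_,
    realNegIndexAtLeast_succ_iff_sInf_lt hK⟩
  exact le_csInf ((exists_realNegIndexAtLeast_iff_encard (n + 1)).2 hK) fun a ha ↦ by
    by_contra hlt
    exact not_realNegIndexAtLeast_succ_of_le_log_two_half (le_of_lt (not_le.1 hlt)) n ha

/-- **Off RH, the first threshold is sharp**: `¬ RH ⟹ ∃ a₀ ≥ (log 2)/2` such that `[-a, a]`
carries a negative even direction iff `a > a₀` (none at `a = a₀`).  RH-free; no claim about which
case holds. [cite: Bombieri2000Weil, §4 Thm 5, Thm 9; Yoshida1992, Thm. 1] -/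
theorem exists_evenNegIndex_threshold_iff_of_not_riemannHypothesis (hRH : ¬ RiemannHypothesis) :
    ∃ a₀ : ℝ, Real.log 2 / 2 ≤ a₀ ∧ ∀ a : ℝ, EvenNegIndexAtLeast 1 a ↔ a₀ < a := by
  refine exists_evenNegIndex_threshold_iff (n := 0) ?_
  have h1 := PfPersistenceParityIndex.one_le_encard_quadrant_of_not_riemannHypothesis hRH
  simpa using h1

/-! ## E. The window index is lower semicontinuous and left-continuous -/

/-- **`a ↦ ind⁻_ev(a)` is lower semicontinuous** (all its level sets are open). RH-free. [folklore] -/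
theorem lowerSemicontinuous_evenNegIndex :
    LowerSemicontinuous fun a : ℝ ↦ (⨆ n : ℕ, ⨆ _ : EvenNegIndexAtLeast n a, (n : ℕ∞)) := by
  intro x y hy
  simp only [lt_iSup_iff] at hy
  obtain ⟨n, hn, hyn⟩ := hy
  filter_upwards [(isOpen_setOf_evenNegIndexAtLeast n).mem_nhds hn] with x' hx'
  exact lt_of_lt_of_le hyn (le_iSup₂ (f := fun (n : ℕ) (_ : EvenNegIndexAtLeast n x') ↦ (n : ℕ∞)) n hx')

/-- `a ↦ ind⁻_od(a)` is lower semicontinuous. RH-free. [folklore] -/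
theorem lowerSemicontinuous_oddNegIndex :
    LowerSemicontinuous fun a : ℝ ↦ (⨆ n : ℕ, ⨆ _ : OddNegIndexAtLeast n a, (n : ℕ∞)) := by
  intro x y hy
  simp only [lt_iSup_iff] at hy
  obtain ⟨n, hn, hyn⟩ := hy
  filter_upwards [(isOpen_setOf_oddNegIndexAtLeast n).mem_nhds hn] with x' hx'
  exact lt_of_lt_of_le hyn (le_iSup₂ (f := fun (n : ℕ) (_ : OddNegIndexAtLeast n x') ↦ (n : ℕ∞)) n hx')

/-- `a ↦ ind⁻_re(a)` is lower semicontinuous. RH-free. [folklore] -/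
theorem lowerSemicontinuous_realNegIndex :
    LowerSemicontinuous fun a : ℝ ↦ (⨆ n : ℕ, ⨆ _ : RealNegIndexAtLeast n a, (n : ℕ∞)) := by
  intro x y hy
  simp only [lt_iSup_iff] at hy
  obtain ⟨n, hn, hyn⟩ := hy
  filter_upwards [(isOpen_setOf_realNegIndexAtLeast n).mem_nhds hn] with x' hx'
  exact lt_of_lt_of_le hyn (le_iSup₂ (f := fun (n : ℕ) (_ : RealNegIndexAtLeast n x') ↦ (n : ℕ∞)) n hx')

/-- **Left continuity of the even window index**: `sup_{b < a} ind⁻_ev(b) = ind⁻_ev(a)` — the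
index jumps just after a threshold, never at it.  RH-free. [folklore] -/
theorem iSup_lt_evenNegIndex_eq (a : ℝ) :
    (⨆ b : ℝ, ⨆ _ : b < a, ⨆ n : ℕ, ⨆ _ : EvenNegIndexAtLeast n b, (n : ℕ∞)) =
      ⨆ n : ℕ, ⨆ _ : EvenNegIndexAtLeast n a, (n : ℕ∞) := by
  refine le_antisymm (iSup₂_le fun b hb ↦ iSup₂_le fun n hn ↦ ?_) (iSup₂_le fun n hn ↦ ?_)
  · exact le_iSup₂ (f := fun (n : ℕ) (_ : EvenNegIndexAtLeast n a) ↦ (n : ℕ∞)) n (hn.mono hb.le)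
  · obtain ⟨b, hba, hb⟩ := hn.exists_lt
    exact (le_iSup₂ (f := fun (n : ℕ) (_ : EvenNegIndexAtLeast n b) ↦ (n : ℕ∞)) n hb).trans
      (le_iSup₂ (f := fun (b : ℝ) (_ : b < a) ↦
        ⨆ n : ℕ, ⨆ _ : EvenNegIndexAtLeast n b, (n : ℕ∞)) b hba)

/-- Left continuity of the real window index. RH-free. [folklore] -/
theorem iSup_lt_realNegIndex_eq (a : ℝ) :
    (⨆ b : ℝ, ⨆ _ : b < a, ⨆ n : ℕ, ⨆ _ : RealNegIndexAtLeast n b, (n : ℕ∞)) =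
      ⨆ n : ℕ, ⨆ _ : RealNegIndexAtLeast n a, (n : ℕ∞) := by
  refine le_antisymm (iSup₂_le fun b hb ↦ iSup₂_le fun n hn ↦ ?_) (iSup₂_le fun n hn ↦ ?_)
  · exact le_iSup₂ (f := fun (n : ℕ) (_ : RealNegIndexAtLeast n a) ↦ (n : ℕ∞)) n (hn.mono hb.le)
  · obtain ⟨b, hba, hb⟩ := hn.exists_lt
    exact (le_iSup₂ (f := fun (n : ℕ) (_ : RealNegIndexAtLeast n b) ↦ (n : ℕ∞)) n hb).trans
      (le_iSup₂ (f := fun (b : ℝ) (_ : b < a) ↦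
        ⨆ n : ℕ, ⨆ _ : RealNegIndexAtLeast n b, (n : ℕ∞)) b hba)

end Summit.RiemannHypothesis.RiemannHypothesis.Theorems.PfPersistenceM2NegIndex
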